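import Summits.CriticalPhenomena.PercolationContinuityZ3.Theses.PercDiodeSteering
import Summits.CriticalPhenomena.PercolationContinuityZ3.Theorems.PercNearOneGluingNoHeavyLowerTailCSHTheoremOne
import Literature.Probability.Percolation.PercolationProofs
import Literature.Probability.Percolation.SharpnessDCTProofs
import Literature.Probability.LatticeModels.LatticeGraph
import HarnessLib

/-!
# `PercDiodeSteering.RDEndpoint` (stmt-CriticalPhenomena-7553) — SETTLED after continuity

Item `stmt-CriticalPhenomena-7553` of route `CriticalPhenomena/PercDiodeSteering` (support (endpoint bookkeeping)): `θ⁺(p, 1) = θ_{ℤ³}(p)`: at `r = 1` the oriented step relation `(x ⋖ z ∧ U_e ≤ p) ∨ (z ⋖ x ∧ U_e ≤ p·1)` is adjacency in the open graph of the coupled configuration `η_p(U) = {e ∈ E(ℤ³) : U_e ≤ p}`, so the label-cluster of 0 is `C(0)` and the standard coupling gives `θ`.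

`zdGraph 3 = SimpleGraph.hasse (Site 3)` (`hasse_adj : Adj x z ↔ x ⋖ z ∨ z ⋖ x`), `openGraph_adj`, `SimpleGraph.reachable_iff_reflTransGen`, `map_configOfLabels_holds` + `Measure.map_apply (measurable_configOfLabels …) (measurableSet_percolatesAt_holds 0)`.  p205010 is NOT used.

builds on p205010 (kernel theorem, internal audit signed; external expert review pending) — USED (`CSH.percolationContinuityZ3_holds`).  RSW3 lane, lead gen 28 (prover-prim-rsw3-lead-g28-0):
'after continuity — the ledger harvest'.
References: G. Kozma, N. Nitzan (2024), Thm. 6 / Conj. 3 [KozmaNitzan2024]; G. Grimmett, *Percolation* (1999), §8 [GrimmettPercolation1999].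
-/

noncomputable section

namespace Summit.CriticalPhenomena.PercolationContinuityZ3.Theorems

namespace PercDiodeSteeringRDEndpoint

open MeasureTheory Literature.Probability.Percolation Literature.Probability.LatticeModels

/-- **`PercDiodeSteering.RDEndpoint` (stmt-CriticalPhenomena-7553), settled.**  hasse adjacency + monotone coupling `map_configOfLabels_holds`.
[cite: KozmaNitzan2024, Thm. 6 with Conj. 3 (p. 15)] -/
theorem rDEndpoint_proof : Summit.CriticalPhenomena.PercolationContinuityZ3.Theses.PercDiodeSteering.RDEndpoint := by
  intro p
  beta_reduce
  haveI := isProbabilityMeasure_labelMeasure (Site 3)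
  -- the step relation at `r = 1` is adjacency in the open graph of the coupled configuration
  have hstep : ∀ U : Sym2 (Site 3) → ℝ, ∀ x z : Site 3,
      ((x ⋖ z ∧ U s(x, z) ≤ (p : ℝ)) ∨ (z ⋖ x ∧ U s(x, z) ≤ (p : ℝ) * 1)) ↔
        (openGraph (configOfLabels (p : ℝ) U (zdGraph 3))).Adj x z := by
    intro U x z
    rw [mul_one, openGraph_adj]
    simp only [configOfLabels, Set.mem_setOf_eq, SimpleGraph.mem_edgeSet, SimpleGraph.hasse_adj]
    constructor
    · rintro (⟨h1, h2⟩ | ⟨h1, h2⟩)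
      · exact ⟨⟨Or.inl h1, h2⟩, h1.ne'.symm⟩
      · exact ⟨⟨Or.inr h1, h2⟩, h1.ne'⟩
    · rintro ⟨⟨h1 | h1, h2⟩, _⟩
      · exact Or.inl ⟨h1, h2⟩
      · exact Or.inr ⟨h1, h2⟩
  have hset : {U : Sym2 (Site 3) → ℝ | {y : Site 3 | Relation.ReflTransGen
      (fun x z : Site 3 => (x ⋖ z ∧ U s(x, z) ≤ (p : ℝ)) ∨ (z ⋖ x ∧ U s(x, z) ≤ (p : ℝ) * 1)) 0 y}.Infinite} =
      (fun U : Sym2 (Site 3) → ℝ => configOfLabels (p : ℝ) U (zdGraph 3)) ⁻¹' percolatesAt (0 : Site 3) := by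
    ext U
    simp only [Set.mem_setOf_eq, Set.mem_preimage, percolatesAt, openCluster]
    have hrel : (fun x z : Site 3 => (x ⋖ z ∧ U s(x, z) ≤ (p : ℝ)) ∨ (z ⋖ x ∧ U s(x, z) ≤ (p : ℝ) * 1)) =
        (openGraph (configOfLabels (p : ℝ) U (zdGraph 3))).Adj := by
      ext x z; exact hstep U x z
    rw [hrel]
    have hS : {y : Site 3 | Relation.ReflTransGen (openGraph (configOfLabels (p : ℝ) U (zdGraph 3))).Adj 0 y} =
        {y : Site 3 | (openGraph (configOfLabels (p : ℝ) U (zdGraph 3))).Reachable 0 y} := by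
      ext y; rw [Set.mem_setOf_eq, Set.mem_setOf_eq, SimpleGraph.reachable_iff_reflTransGen]
    rw [hS]
  rw [hset, theta, ← map_configOfLabels_holds (zdGraph 3) p, measureReal_def, measureReal_def,
    Measure.map_apply (measurable_configOfLabels _ _) (measurableSet_percolatesAt_holds (0 : Site 3))]

end PercDiodeSteeringRDEndpoint

end Summit.CriticalPhenomena.PercolationContinuityZ3.Theorems

end
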